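import Mathlib.MeasureTheory.Integral.IntervalIntegral.IntegrationByParts
import Mathlib.MeasureTheory.Measure.OpenPos
import Literature.Analysis.FunctionSpaces.DistributionalConstancy
import Literature.Analysis.FunctionSpaces.TorusSpaceTimeFields
import Literature.Analysis.FunctionSpaces.TorusTestFunction
import Literature.Analysis.FunctionSpaces.TorusFluidGlue
import HarnessLib

/-!
# The total kinetic energy of a flow with a local energy balance (De Lellis–Kwon 2022, §2.3)

Support file for the named fact `Torus.DeLellisKwon2022_thm11` (`GloballyDissipativeEuler`):
the last step of the printed proof of De Lellis–Kwon, Anal. PDE 15 (2022), Thm. 1.1 (§2.3,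
p. 7 of arXiv:2006.06482v2): once the limit flow `(v, p)` satisfies the local energy balance
`∂ₜ(½|v|²) + ∇·((½|v|² + p) v) = E'` in `𝒟'((0,T) × T³)` for a `C¹` time profile `E`, "since
any time-dependent function `χ ∈ C_c^∞((0,T))` would be an admissible test function, we conclude
`-∫ ∂ₜχ ∫ ½|v|² dx dt = ∫ E' χ dt`. Given that `E` is `C¹`, the latter implies that the total
kinetic energy is a `C¹` function and it in facts coincides with `E` up to a constant, namely
`∫ ½|v|²(T,x) dx - ∫ ½|v|²(0,x) dx = E(T) - E(0)`."

## Contents (all proved)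

* `sub_eq_neg_setIntegral_of_forall_deriv_mul_eq` — the one-dimensional lemma behind the
  quotation: if `e, D` are continuous on `[0,T]` and `∫_{(0,T)} η' e = ∫_{(0,T)} η D` for every
  test function `η` on `(0,T)` (i.e. `e' = -D` in `𝒟'(0,T)`), then `e(T) - e(0) = -∫_{(0,T)} D`
  (du Bois-Reymond: the tree's `FunctionSpaces.ae_eq_const_of_forall_setIntegral_deriv_mul_eq_zero`
  applied to `e + ∫₀ D`, plus continuity up to the endpoints).
* `isSpaceTimeTestIoo_of_time` — a test function `η ∈ C_c^∞((0,T))` of time alone is an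
  admissible space–time test function (`FunctionSpaces.Torus.IsSpaceTimeTestIoo`), with
  `∂ₜ = η'` and `∇ = 0`.
* `kineticEnergy_sub_eq_neg_setIntegral_of_localEnergyBalance` — for a velocity field with
  continuous space–time lift on `[0,T] × T^d` whose local energy balance against scalar tests has
  a defect `∫₀ᵀ D(t) ∫ ψ(t,x) dx dt` with `D` continuous on `[0,T]`,
  `½∫|u(T)|² - ½∫|u(0)|² = -∫_{(0,T)} D`; and the strict drop
  `kineticEnergy_lt_of_localEnergyBalance` when `∫_{(0,T)} D > 0` — the shape of (Onsager) in
  De Lellis–Kwon, Thm. 1.1.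

## References

* C. De Lellis, H. Kwon, *On nonuniqueness of Hölder continuous globally dissipative Euler
  flows*, Anal. PDE 15 (2022) 2003–2059 = arXiv:2006.06482, §2.3. [DelellisKwon2022]
* H. Brezis, *Functional Analysis, Sobolev Spaces and PDE* (2011), Lemma 8.1, Cor. 8.10.
-/

noncomputable section

open MeasureTheory Set Filter Function intervalIntegral
open scoped InnerProductSpace RealInnerProductSpace ENNReal NNReal ContDiff Topology

namespace Literature.Analysis.FluidPDE.Torus

/-! ### The one-dimensional lemma: `e' = -D` weakly on `(0,T)` with continuous `e`, `D` -/

/-- **`e' = -D` in `𝒟'(0,T)` for continuous `e, D` on `[0,T]` gives `e(T) - e(0) = -∫₀ᵀ D`.**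
If `e` and `D` are continuous on `[0,T]`, `0 < T`, and `∫_{(0,T)} η' e = ∫_{(0,T)} η D` for every
smooth compactly supported `η` with `tsupport η ⊆ (0,T)`, then `e T - e 0 = -∫_{(0,T)} D`.
Proof: with `G(t) = ∫₀ᵗ D`, integration by parts gives `∫ η D = -∫ η' G`, so `∫ η' (e + G) = 0`
for all such `η`; hence `e + G` is a.e. constant on `(0,T)` (Brezis 2011, Lemma 8.1 / Cor. 8.10,
the tree's `FunctionSpaces.ae_eq_const_of_forall_setIntegral_deriv_mul_eq_zero`), and by
continuity constant on `[0,T]` (De Lellis–Kwon 2022, §2.3: "the total kinetic energy ...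
coincides with `E` up to a constant"). [cite: DelellisKwon2022, §2.3] -/
theorem sub_eq_neg_setIntegral_of_forall_deriv_mul_eq {T : ℝ} (hT : 0 < T) {e D : ℝ → ℝ}
    (he : ContinuousOn e (Icc 0 T)) (hD : ContinuousOn D (Icc 0 T))
    (h : ∀ η : ℝ → ℝ, ContDiff ℝ ∞ η → HasCompactSupport η → tsupport η ⊆ Ioo 0 T →
      ∫ t in Ioo 0 T, deriv η t * e t = ∫ t in Ioo 0 T, η t * D t) :
    e T - e 0 = -∫ t in Ioo 0 T, D t := by
  -- continuous extension of `D` to `ℝ` and its primitive `G`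
  set D' : ℝ → ℝ := fun t => D (max 0 (min t T)) with hD'
  have hmem : ∀ t, max 0 (min t T) ∈ Icc 0 T := fun t =>
    ⟨le_max_left _ _, max_le hT.le (min_le_right _ _)⟩
  have hD'c : Continuous D' :=
    hD.comp_continuous (continuous_const.max (continuous_id.min continuous_const)) hmem
  have hD'eq : ∀ t ∈ Icc 0 T, D' t = D t := fun t ht => by
    simp only [hD', min_eq_left ht.2, max_eq_right ht.1]
  set G : ℝ → ℝ := fun t => ∫ s in (0 : ℝ)..t, D' s with hG
  have hGd : ∀ t, HasDerivAt G (D' t) t := fun t =>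
    (hD'c.integral_hasStrictDerivAt 0 t).hasDerivAt
  have hGc : Continuous G := continuous_iff_continuousAt.2 fun t => (hGd t).continuousAt
  -- `∫_{(0,T)} η' (e + G) = 0` for every test function `η` on `(0,T)`
  have hEG : IntegrableOn (fun t => e t + G t) (Ioo 0 T) :=
    ((he.add hGc.continuousOn).integrableOn_compact isCompact_Icc).mono_set Ioo_subset_Icc_self
  have hzero : ∀ η : ℝ → ℝ, ContDiff ℝ ∞ η → HasCompactSupport η → tsupport η ⊆ Ioo 0 T →
      ∫ t in Ioo 0 T, deriv η t * (e t + G t) = 0 := by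
    intro η hη hηc hηs
    obtain ⟨a, b, ha, -, hb, hab⟩ :=
      FunctionSpaces.exists_Icc_subset_Ioo_of_tsupport_subset hT hηc hηs
    have hη0 : η 0 = 0 := by
      by_contra h0; exact absurd (hab 0 h0).1 (not_le.2 ha)
    have hηT : η T = 0 := by
      by_contra h0; exact absurd (hab T h0).2 (not_le.2 hb)
    have hηd : ∀ t, HasDerivAt η (deriv η t) t := fun t =>
      ((hη.differentiable (by simp)) t).hasDerivAt
    have hη'c : Continuous (deriv η) := hη.continuous_deriv (by simp)
    have hei : IntegrableOn (fun t => deriv η t * e t) (Ioo 0 T) :=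
      ((hη'c.continuousOn.mul he).integrableOn_compact isCompact_Icc).mono_set
        Ioo_subset_Icc_self
    have hGi : IntegrableOn (fun t => deriv η t * G t) (Ioo 0 T) :=
      ((hη'c.mul hGc).integrableOn_Icc).mono_set Ioo_subset_Icc_self
    -- integration by parts on `[0, T]`: `∫ η D' = -∫ η' G`
    have hibp : ∫ t in Ioo 0 T, η t * D' t = -∫ t in Ioo 0 T, deriv η t * G t := by
      rw [← integral_Ioc_eq_integral_Ioo, ← intervalIntegral.integral_of_le hT.le,
        ← integral_Ioc_eq_integral_Ioo, ← intervalIntegral.integral_of_le hT.le,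
        intervalIntegral.integral_mul_deriv_eq_deriv_mul (fun t _ => hηd t) (fun t _ => hGd t)
          (hη'c.intervalIntegrable _ _) (hD'c.intervalIntegrable _ _), hη0, hηT]
      simp
    have hDD' : ∫ t in Ioo 0 T, η t * D t = ∫ t in Ioo 0 T, η t * D' t :=
      setIntegral_congr_fun measurableSet_Ioo fun t ht => by
        rw [hD'eq t (Ioo_subset_Icc_self ht)]
    calc ∫ t in Ioo 0 T, deriv η t * (e t + G t)
        = (∫ t in Ioo 0 T, deriv η t * e t) + ∫ t in Ioo 0 T, deriv η t * G t := by
          simp_rw [mul_add]; exact integral_add hei hGi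
      _ = 0 := by rw [h η hη hηc hηs, hDD', hibp, neg_add_cancel]
  -- hence `e + G` is a.e. constant on `(0,T)`, and constant on `[0,T]` by continuity
  obtain ⟨c, hc⟩ := FunctionSpaces.ae_eq_const_of_forall_setIntegral_deriv_mul_eq_zero hEG hzero
  have hcIcc : ∀ᵐ t ∂(volume.restrict (Icc 0 T)), e t + G t = c := by
    rwa [← Measure.restrict_congr_set Ioo_ae_eq_Icc]
  have hEq : EqOn (fun t => e t + G t) (fun _ => c) (Icc 0 T) := by
    refine Measure.eqOn_of_ae_eq hcIcc (he.add hGc.continuousOn) continuousOn_const ?_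
    rw [interior_Icc, closure_Ioo hT.ne]
  have h0 := hEq ⟨le_rfl, hT.le⟩
  have h1 := hEq ⟨hT.le, le_rfl⟩
  simp only at h0 h1
  have hG0 : G 0 = 0 := by simp [hG]
  have hGT : G T = ∫ t in Ioo 0 T, D t := by
    simp only [hG]
    rw [intervalIntegral.integral_of_le hT.le, integral_Ioc_eq_integral_Ioo]
    exact setIntegral_congr_fun measurableSet_Ioo fun t ht => hD'eq t (Ioo_subset_Icc_self ht)
  linarith

/-! ### Test functions of time alone -/

variable {d : Type*} [Fintype d]

/-- A smooth compactly supported function of time with support in `(0,T)` is, as a function on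
`ℝ × T^d` constant in space, an admissible space–time test function compactly supported in
`(0,T)` (De Lellis–Kwon 2022, §2.3: "any time-dependent function `χ ∈ C_c^∞((0,T))` would be an
admissible test function"). [cite: DelellisKwon2022, §2.3] -/
theorem isSpaceTimeTestIoo_of_time {T : ℝ} (hT : 0 < T) {η : ℝ → ℝ} (hη : ContDiff ℝ ∞ η)
    (hηc : HasCompactSupport η) (hηs : tsupport η ⊆ Ioo 0 T) :
    FunctionSpaces.Torus.IsSpaceTimeTestIoo T (fun (t : ℝ) (_ : UnitAddTorus d) => η t) := by
  obtain ⟨a, b, ha, -, hb, hab⟩ :=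
    FunctionSpaces.exists_Icc_subset_Ioo_of_tsupport_subset hT hηc hηs
  have hz : ∀ t, t ∉ Icc a b → η t = 0 := fun t ht => by
    by_contra h0; exact ht (hab t h0)
  refine ⟨⟨hη.comp contDiff_fst, (b + T) / 2, by linarith, fun t ht => ?_⟩, a / 2, by linarith,
    fun t ht => ?_⟩
  · funext x
    exact hz t fun h' => by linarith [h'.2]
  · funext x
    exact hz t fun h' => by linarith [h'.1]

omit [Fintype d] in
/-- The time derivative of a test function of time alone. [folklore] -/
@[simp]
theorem timeDeriv_of_time (η : ℝ → ℝ) (t : ℝ) (x : UnitAddTorus d) :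
    FunctionSpaces.Torus.timeDeriv (fun (s : ℝ) (_ : UnitAddTorus d) => η s) t x = deriv η t :=
  rfl

/-! ### The energy identity -/

/-- **Total kinetic energy under a local energy balance with a time-only defect**
(De Lellis–Kwon 2022, §2.3). Let `u` have a continuous space–time lift on `[0,T] × T^d`, let `D`
be continuous on `[0,T]`, and assume the local energy balance
`∫₀ᵀ∫ (½|u|² ∂ₜψ + (½|u|² + p) ⟪u, ∇ψ⟫) = ∫₀ᵀ D(t) ∫ ψ(t,x) dx dt` for every smooth scalar test
function `ψ` compactly supported in time in `(0,T)` (i.e.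
`∂ₜ(½|u|²) + ∇·((½|u|² + p) u) = -D(t)` in `𝒟'`). Then
`½∫|u(T)|² - ½∫|u(0)|² = -∫_{(0,T)} D`. Proof: test with `ψ(t,x) = η(t)`
(`isSpaceTimeTestIoo_of_time`), for which `∇ψ = 0` and the balance reads `∫ η' e = ∫ η D` with
`e(t) = ½∫|u(t)|²` continuous on `[0,T]`; conclude by
`sub_eq_neg_setIntegral_of_forall_deriv_mul_eq`. [cite: DelellisKwon2022, §2.3] -/
theorem kineticEnergy_sub_eq_neg_setIntegral_of_localEnergyBalance {T : ℝ} (hT : 0 < T)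
    {u : ℝ → UnitAddTorus d → EuclideanSpace ℝ d} {p : ℝ → UnitAddTorus d → ℝ} {D : ℝ → ℝ}
    (hu : ContinuousOn (FunctionSpaces.Torus.stLift u) (Icc 0 T ×ˢ univ))
    (hD : ContinuousOn D (Icc 0 T))
    (h : ∀ ψ : ℝ → UnitAddTorus d → ℝ, FunctionSpaces.Torus.IsSpaceTimeTestIoo T ψ →
      ∫ t in Ioo 0 T, ∫ x, (2⁻¹ * ‖u t x‖ ^ 2 * FunctionSpaces.Torus.timeDeriv ψ t x +
        (2⁻¹ * ‖u t x‖ ^ 2 + p t x) * ⟪u t x, FunctionSpaces.Torus.gradient (ψ t) x⟫_ℝ) =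
      ∫ t in Ioo 0 T, D t * ∫ x, ψ t x) :
    FunctionSpaces.Torus.kineticEnergy (u T) - FunctionSpaces.Torus.kineticEnergy (u 0) =
      -∫ t in Ioo 0 T, D t := by
  have he : ContinuousOn (fun t => FunctionSpaces.Torus.kineticEnergy (u t)) (Icc 0 T) :=
    continuousOn_const.mul (FunctionSpaces.Torus.continuousOn_integral_norm_sq_of_continuousOn_stLift hu)
  refine sub_eq_neg_setIntegral_of_forall_deriv_mul_eq hT he hD fun η hη hηc hηs => ?_
  have hid := h _ (isSpaceTimeTestIoo_of_time (d := d) hT hη hηc hηs)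
  -- the spatial gradient of a function constant in space vanishes
  -- (cf. `Torus.gradient_const` in `NavierStokesConcentrationTools`, not imported here)
  have hg : ∀ (c : ℝ) (x : UnitAddTorus d),
      FunctionSpaces.Torus.gradient (fun _ : UnitAddTorus d => c) x = 0 := fun c x => by
    unfold FunctionSpaces.Torus.gradient FunctionSpaces.Torus.liftAt
    simp [_root_.gradient]
  simp only [timeDeriv_of_time, hg, inner_zero_right, mul_zero, add_zero] at hid
  have hl : ∀ t, ∫ x, 2⁻¹ * ‖u t x‖ ^ 2 * deriv η t =
      deriv η t * FunctionSpaces.Torus.kineticEnergy (u t) := fun t => by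
    rw [MeasureTheory.integral_mul_const, MeasureTheory.integral_const_mul,
      FunctionSpaces.Torus.kineticEnergy, mul_comm]
  have hr : ∀ t, D t * ∫ _ : UnitAddTorus d, η t = η t * D t := fun t => by
    rw [MeasureTheory.integral_const, smul_eq_mul]
    simp [mul_comm]
  simp only [hl, hr] at hid
  exact hid

/-- **Strict energy drop** (the shape of (Onsager) in De Lellis–Kwon 2022, Thm. 1.1): under the
hypotheses of `kineticEnergy_sub_eq_neg_setIntegral_of_localEnergyBalance`, if the total defect
`∫_{(0,T)} D` is positive then `½∫|u(T)|² < ½∫|u(0)|²`. [cite: DelellisKwon2022, §2.3] -/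
theorem kineticEnergy_lt_of_localEnergyBalance {T : ℝ} (hT : 0 < T)
    {u : ℝ → UnitAddTorus d → EuclideanSpace ℝ d} {p : ℝ → UnitAddTorus d → ℝ} {D : ℝ → ℝ}
    (hu : ContinuousOn (FunctionSpaces.Torus.stLift u) (Icc 0 T ×ˢ univ))
    (hD : ContinuousOn D (Icc 0 T))
    (h : ∀ ψ : ℝ → UnitAddTorus d → ℝ, FunctionSpaces.Torus.IsSpaceTimeTestIoo T ψ →
      ∫ t in Ioo 0 T, ∫ x, (2⁻¹ * ‖u t x‖ ^ 2 * FunctionSpaces.Torus.timeDeriv ψ t x +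
        (2⁻¹ * ‖u t x‖ ^ 2 + p t x) * ⟪u t x, FunctionSpaces.Torus.gradient (ψ t) x⟫_ℝ) =
      ∫ t in Ioo 0 T, D t * ∫ x, ψ t x)
    (hpos : 0 < ∫ t in Ioo 0 T, D t) :
    FunctionSpaces.Torus.kineticEnergy (u T) < FunctionSpaces.Torus.kineticEnergy (u 0) := by
  have := kineticEnergy_sub_eq_neg_setIntegral_of_localEnergyBalance hT hu hD h
  linarith

end Literature.Analysis.FluidPDE.Torus
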